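import Summits.BirchSwinnertonDyer.BirchSwinnertonDyer.Theses.TangentCone
import Literature.NumberTheory.EllipticCurves.IwasawaLeadingTermProofs
import Literature.Barriers.BirchSwinnertonDyer.SelmerVersusMordellWeilProofs
import Literature.NumberTheory.EllipticCurves.BSDSelmer

/-!
# Crux `SelmerRankShaPFinite` (stmt-BirchSwinnertonDyer-0132) — crux-ideate round 2, ideator k = 4:
# kernel-checked companion to NOTES.md (`## Barrier notes`)

No idea card is filed by this seat (see NOTES.md for the census of levers examined). This file
certifies, sorry-free and from tree theorems plus ONE named literature fact taken as hypothesis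
(`PParityAll` = Dokchitser–Dokchitser 2010 Thm 1.4, tree `selmerCorank_mod_two_eq`), three
structural facts about the crux AS FILED (∀ E/ℚ ∀ p, `Ш(E/ℚ)[p^∞]` finite) that every future line
must honour:

* `shaCorank_mod_two_indep` — the parity of the phantom corank `t_p := corank_ℤₚ Ш(E/ℚ)[p^∞]` is
  INDEPENDENT of `p` (p-parity at two primes + Greenberg's identity). Hence
  `odd_catastrophe`: one prime with odd `t_p` forces `t_q ≥ 1` at EVERY prime `q`
  (`Ш(E/ℚ) ⊇ ℚ/ℤ`), and `crux_at_one_prime_gives_even_everywhere`: the crux at a single prime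
  already forces `t_q` even at all `q`.
* `mwParityAll_of_crux` — the crux implies the Mordell–Weil parity conjecture for every `E/ℚ`
  (a p-FREE open statement), and
* `oddAnalyticRankHasPoint_of_crux` — the crux implies, UNIFORMLY IN `E`, that every elliptic curve
  over `ℚ` of odd analytic rank has a rational point of infinite order. So any line closing the
  crux by name contains a rank-≥-1 point-existence theorem for all curves with `w(E) = -1` and
  `r_an ≥ 3` (open; Gross–Zagier–Kolyvagin covers `r_an = 1` only) — the "hidden point" is not only
  in the consumed instance (census `finite_at_iff_bsd_at`) but in the universally quantified
  statement itself.
* `crux_iff_noOddPhantom_and_noPhantomPair` — the exact p-free/p-adic split: crux ⟺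
  (MW parity for all E) ∧ (∀ E p, `t_p` even → `t_p = 0`), given p-parity.
-/

set_option linter.dupNamespace false

namespace Summit.BirchSwinnertonDyer.BirchSwinnertonDyer.Cruxes.SelmerRankShaPFinite.IdeateR2K4

open Summit.BirchSwinnertonDyer.BirchSwinnertonDyer.Theses.TangentCone
open WeierstrassCurve Literature.NumberTheory.EllipticCurves

/-- The `p`-parity theorem for every `E/ℚ` and every prime (Dokchitser–Dokchitser 2010, Thm. 1.4;
tree fact `selmerCorank_mod_two_eq`, unproved in tree in this generality), as ONE hypothesis. -/
def PParityAll : Prop :=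
  ∀ (W : WeierstrassCurve ℚ) [W.IsElliptic] (p : ℕ) [Fact p.Prime], selmerCorank_mod_two_eq W p

/-- Mordell–Weil parity for every elliptic curve over `ℚ` (open). -/
def MWParityAll : Prop :=
  ∀ (W : WeierstrassCurve ℚ) [W.IsElliptic], W.mordellWeilRank % 2 = W.analyticRank % 2

/-- "Odd analytic rank has a point": every `E/ℚ` with odd `ord_{s=1} L(E,s)` has positive rank
(open beyond `r_an = 1`). -/
def OddAnalyticRankHasPoint : Prop :=
  ∀ (W : WeierstrassCurve ℚ) [W.IsElliptic], Odd W.analyticRank → 1 ≤ W.mordellWeilRank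

/-- "No odd phantom": the phantom corank is even at every prime. -/
def NoOddPhantom : Prop :=
  ∀ (W : WeierstrassCurve ℚ) [W.IsElliptic] (p : ℕ) [Fact p.Prime], Even (W.shaCorank p)

/-- "No phantom pair": an even phantom corank vanishes. -/
def NoPhantomPair : Prop :=
  ∀ (W : WeierstrassCurve ℚ) [W.IsElliptic] (p : ℕ) [Fact p.Prime], Even (W.shaCorank p) → W.shaCorank p = 0

variable (W : WeierstrassCurve ℚ) [W.IsElliptic]

/-- Dictionary: the crux gives `corank Ш[p^∞] = 0` pointwise (cofinite generation, tree). -/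
theorem shaCorank_eq_zero_of_crux (h : SelmerRankShaPFinite) (p : ℕ) [Fact p.Prime] :
    W.shaCorank p = 0 :=
  (finite_primaryComponent_sha_iff_shaCorank_eq_zero W p).mp (h W p)

/-- **The parity of `t_p` does not depend on `p`** (p-parity at `p` and `q` + Greenberg). -/
theorem shaCorank_mod_two_indep (hpar : PParityAll) (p q : ℕ) [Fact p.Prime] [Fact q.Prime] :
    W.shaCorank p % 2 = W.shaCorank q % 2 := by
  have a : W.selmerCorank p % 2 = W.analyticRank % 2 := hpar W p
  have b : W.selmerCorank q % 2 = W.analyticRank % 2 := hpar W q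
  have c : W.selmerCorank p = W.mordellWeilRank + W.shaCorank p :=
    W.selmerCorank_eq_mordellWeilRank_add_holds p
  have d : W.selmerCorank q = W.mordellWeilRank + W.shaCorank q :=
    W.selmerCorank_eq_mordellWeilRank_add_holds q
  omega

/-- **Odd catastrophe.** An odd phantom corank at ONE prime forces a non-trivial divisible part
of `Ш(E/ℚ)[q^∞]` at EVERY prime `q` (so `Ш(E/ℚ) ⊇ ℚ/ℤ`). -/
theorem odd_catastrophe (hpar : PParityAll) (p q : ℕ) [Fact p.Prime] [Fact q.Prime]
    (hp : ¬ Even (W.shaCorank p)) : 1 ≤ W.shaCorank q := by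
  have e := shaCorank_mod_two_indep W hpar p q
  rw [Nat.even_iff] at hp
  omega

/-- The crux at a single prime `p` already makes `t_q` even at every prime `q`. -/
theorem even_everywhere_of_finite_at_one_prime (hpar : PParityAll) (p q : ℕ) [Fact p.Prime]
    [Fact q.Prime] (hfin : Finite ↥(AddCommGroup.primaryComponent W.sha p)) :
    Even (W.shaCorank q) := by
  have h0 : W.shaCorank p = 0 := (finite_primaryComponent_sha_iff_shaCorank_eq_zero W p).mp hfin
  have e := shaCorank_mod_two_indep W hpar p q
  rw [Nat.even_iff]
  omega

/-- **The crux implies Mordell–Weil parity for every `E/ℚ`.** -/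
theorem mwParityAll_of_crux (hpar : PParityAll) (h : SelmerRankShaPFinite) : MWParityAll := by
  intro W _
  haveI : Fact (Nat.Prime 2) := ⟨Nat.prime_two⟩
  have e1 : W.selmerCorank 2 % 2 = W.analyticRank % 2 := hpar W 2
  have e2 : W.selmerCorank 2 = W.mordellWeilRank + W.shaCorank 2 :=
    W.selmerCorank_eq_mordellWeilRank_add_holds 2
  have e3 : W.shaCorank 2 = 0 := shaCorank_eq_zero_of_crux W h 2
  omega

/-- **Hidden point, uniformly in `E`.** The crux implies that every elliptic curve over `ℚ` of odd
analytic rank has a rational point of infinite order. -/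
theorem oddAnalyticRankHasPoint_of_crux (hpar : PParityAll) (h : SelmerRankShaPFinite) :
    OddAnalyticRankHasPoint := by
  intro W _ hodd
  have e : W.mordellWeilRank % 2 = W.analyticRank % 2 := mwParityAll_of_crux hpar h W
  obtain ⟨k, hk⟩ := hodd
  omega

/-- The crux implies `NoOddPhantom` trivially, and `NoOddPhantom ↔ MWParityAll` given p-parity. -/
theorem noOddPhantom_iff_mwParityAll (hpar : PParityAll) : NoOddPhantom ↔ MWParityAll := by
  constructor
  · intro hno W _
    haveI : Fact (Nat.Prime 2) := ⟨Nat.prime_two⟩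
    have e1 : W.selmerCorank 2 % 2 = W.analyticRank % 2 := hpar W 2
    have e2 : W.selmerCorank 2 = W.mordellWeilRank + W.shaCorank 2 :=
      W.selmerCorank_eq_mordellWeilRank_add_holds 2
    have e3 : Even (W.shaCorank 2) := hno W 2
    rw [Nat.even_iff] at e3
    omega
  · intro hmw W _ p _
    have e1 : W.selmerCorank p % 2 = W.analyticRank % 2 := hpar W p
    have e2 : W.selmerCorank p = W.mordellWeilRank + W.shaCorank p :=
      W.selmerCorank_eq_mordellWeilRank_add_holds p
    have e3 : W.mordellWeilRank % 2 = W.analyticRank % 2 := hmw W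
    rw [Nat.even_iff]
    omega

/-- **The exact p-free / p-adic split of the crux.** Given p-parity:
crux ⟺ (Mordell–Weil parity for every `E/ℚ`) ∧ (no phantom PAIRS at any prime). -/
theorem crux_iff_mwParityAll_and_noPhantomPair (hpar : PParityAll) :
    SelmerRankShaPFinite ↔ MWParityAll ∧ NoPhantomPair := by
  constructor
  · intro h
    exact ⟨mwParityAll_of_crux hpar h, fun W _ p _ _ => shaCorank_eq_zero_of_crux W h p⟩
  · rintro ⟨hmw, hpair⟩ W _ p _
    have hev : Even (W.shaCorank p) := (noOddPhantom_iff_mwParityAll hpar).2 hmw W p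
    exact (finite_primaryComponent_sha_iff_shaCorank_eq_zero W p).mpr (hpair W p hev)

end Summit.BirchSwinnertonDyer.BirchSwinnertonDyer.Cruxes.SelmerRankShaPFinite.IdeateR2K4
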